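import Literature.NumberTheory.LFunctions.UniformClassGroupPNTChebyshev
import Literature.NumberTheory.LFunctions.ClassGroupLFunctionInversion
import HarnessLib

/-!
# Chebyshev functions twisted by class group characters and the orthogonality identity
# `θ_C(x) = h⁻¹ Σ_ψ ψ(C⁻¹) θ(x, ψ)`

Topic `Literature/NumberTheory/LFunctions` (namespace `Literature.NumberTheory.LFunctions.NumberField`),
continuing `UniformClassGroupPNTChebyshev.lean` (`θ_C = chebyshevThetaIdealClass`, the Chebyshev
function of an ideal class) and `ClassGroupLFunctionInversion.lean` (enumeration of the class group
characters through `ψ : AddChar (Additive Cl_K) ℂ`, orthogonality `Σ_ψ ψ(𝔎) = h·[𝔎 = 1]`).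
Everything here is PROVED (one definition with body, theorems).

This is the step "`(|G|/|C|) ψ̃_C(x; f) = Σ_χ χ̄(C) I_χ`" ((4.2), Mellin inversion summed over the
characters of `Gal(H_K/K) ≅ Cl_K`) of the proof of [ThornerZaman2019, Lemma 4.3], on the prime-sum
side and for the unsmoothed `θ`:

* `chebyshevThetaIdealChar K χ x` — `θ(x, χ) = Σ_C χ(C) θ_C(x) = Σ_{N𝔭 ≤ x} χ([𝔭]) log N𝔭`
  (`chebyshevThetaIdealChar_eq_sum_primeIdealsLE`);
* `sum_apply_inv_mul_chebyshevThetaIdealChar` — `Σ_ψ ψ(C⁻¹) θ(x, ψ) = h · θ_C(x)`;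
* `chebyshevThetaIdealClass_eq_sum_chebyshevThetaIdealChar` — **`θ_C(x) = h⁻¹ Σ_ψ ψ(C⁻¹) θ(x, ψ)`**
  (finite Fourier inversion on `Cl_K`), the identity through which character-wise asymptotics
  for `θ(x, χ)` (trivial character: `∼ x`; exceptional real `χ₁`: `∼ −x^{β₁}/β₁`; others: `o(x)`)
  yield the class-wise statement `θ_C(x) ∼ h⁻¹(x − χ₁(C) x^{β₁}/β₁)`;
* `chebyshevThetaIdealChar_one` — `θ(x, 1) = θ_K(x)`, and `norm_chebyshevThetaIdealChar_le` —
  `|θ(x, χ)| ≤ θ_K(x)`.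

## References

* J. Thorner, A. Zaman, *A unified and improved Chebotarev density theorem*, Algebra Number
  Theory 13 (2019) 1039–1068, §4.2, Lemma 4.3, (4.2). [ThornerZaman2019]
-/

noncomputable section

open scoped NumberField nonZeroDivisors
open Finset Complex NumberField
open Literature.NumberTheory.LFunctions.AbelianDensity (toMulHom toMulHom_apply)

namespace Literature.NumberTheory.LFunctions.NumberField

variable (K : Type*) [Field K] [NumberField K]

/-- **The Chebyshev function twisted by a class group character**,
`θ(x, χ) = Σ_C χ(C) θ_C(x)` (`= Σ_{N𝔭 ≤ x} χ([𝔭]) log N𝔭`,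
`chebyshevThetaIdealChar_eq_sum_primeIdealsLE`) — the prime-sum counterpart of the character
sums `Σ Λ 1_C f` / `I_χ` of [ThornerZaman2019, §4.2]. [cite: ThornerZaman2019, §4.2 (4.2)] -/
def chebyshevThetaIdealChar (χ : ClassGroup (𝓞 K) →* ℂˣ) (x : ℝ) : ℂ :=
  ∑ C : ClassGroup (𝓞 K), (χ C : ℂ) * (chebyshevThetaIdealClass K C x : ℂ)

variable {K}

/-- `θ(x, 1) = θ_K(x)`. [folklore] -/
theorem chebyshevThetaIdealChar_one (x : ℝ) :
    chebyshevThetaIdealChar K 1 x = (chebyshevThetaIdeal K x : ℂ) := by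
  simp only [chebyshevThetaIdealChar, MonoidHom.one_apply, Units.val_one, one_mul]
  rw [← ofReal_sum, sum_chebyshevThetaIdealClass]

/-- `|θ(x, χ)| ≤ θ_K(x)` (`|χ| = 1`, `θ_C ≥ 0`, `Σ_C θ_C = θ_K`). [folklore] -/
theorem norm_chebyshevThetaIdealChar_le (χ : ClassGroup (𝓞 K) →* ℂˣ) (x : ℝ) :
    ‖chebyshevThetaIdealChar K χ x‖ ≤ chebyshevThetaIdeal K x := by
  rw [chebyshevThetaIdealChar, ← sum_chebyshevThetaIdealClass K x]
  refine (norm_sum_le _ _).trans (le_of_eq (sum_congr rfl fun C _ ↦ ?_))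
  rw [norm_mul, norm_classGroupChar_apply, one_mul, Complex.norm_real, Real.norm_eq_abs,
    abs_of_nonneg (chebyshevThetaIdealClass_nonneg C x)]

open scoped Classical in
/-- **`θ(x, χ) = Σ_{N𝔭 ≤ x} χ([𝔭]) log N𝔭`**: regrouping the primes of norm `≤ x` by their classes
(for `x ≥ 0`; the summand at `𝔭` is `χ([𝔭]) log N𝔭`, written with the membership proof
`𝔭 ∈ (Ideal 𝓞_K)⁰`). [cite: ThornerZaman2019, §4.2] -/
theorem chebyshevThetaIdealChar_eq_sum_primeIdealsLE (χ : ClassGroup (𝓞 K) →* ℂˣ) {x : ℝ}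
    (hx : 0 ≤ x) :
    chebyshevThetaIdealChar K χ x =
      ∑ P ∈ (finite_primeIdealsLE K x).toFinset,
        (if h : P ∈ (Ideal (𝓞 K))⁰ then (χ (ClassGroup.mk0 ⟨P, h⟩) : ℂ) else 0) *
          (Real.log (Ideal.absNorm P) : ℂ) := by
  let cl : Ideal (𝓞 K) → ClassGroup (𝓞 K) := fun P ↦
    if h : P ∈ (Ideal (𝓞 K))⁰ then ClassGroup.mk0 ⟨P, h⟩ else 1
  rw [chebyshevThetaIdealChar, ← sum_fiberwise_of_maps_to (g := cl) (t := univ)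
    (s := (finite_primeIdealsLE K x).toFinset) fun _ _ ↦ mem_univ _]
  refine sum_congr rfl fun C _ ↦ ?_
  rw [chebyshevThetaIdealClass_eq_sum_primeIdealsInClassLE K C hx, ofReal_sum, mul_sum]
  -- the fibre of `cl` over `C` inside the primes of norm `≤ x` is `primeIdealsInClassLE C x`
  have hfib : ((finite_primeIdealsLE K x).toFinset.filter fun P ↦ cl P = C) =
      (finite_primeIdealsInClassLE C x).toFinset := by
    ext P
    simp only [mem_filter, Set.Finite.mem_toFinset, primeIdealsLE, primeIdealsInClassLE,
      Set.mem_setOf_eq]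
    constructor
    · rintro ⟨⟨hP, h0, hPx⟩, hC⟩
      have h0' : P ∈ (Ideal (𝓞 K))⁰ := mem_nonZeroDivisors_of_ne_zero h0
      change (if h : P ∈ (Ideal (𝓞 K))⁰ then ClassGroup.mk0 ⟨P, h⟩ else 1) = C at hC
      rw [dif_pos h0'] at hC
      exact ⟨hP, hPx, h0', hC⟩
    · rintro ⟨hP, hPx, h0, hC⟩
      refine ⟨⟨hP, nonZeroDivisors.ne_zero h0, hPx⟩, ?_⟩
      change (if h : P ∈ (Ideal (𝓞 K))⁰ then ClassGroup.mk0 ⟨P, h⟩ else 1) = C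
      rw [dif_pos h0]
      exact hC
  rw [hfib]
  refine sum_congr rfl fun P hP ↦ ?_
  rw [Set.Finite.mem_toFinset] at hP
  obtain ⟨-, -, h0, hC⟩ := hP
  rw [dif_pos h0, hC]

/-! ### Orthogonality -/

/-- **`Σ_ψ ψ(C⁻¹) θ(x, ψ) = h · θ_C(x)`** (`h = h_K`): orthogonality of the characters of `Cl_K`
(`sum_classGroupChar_apply_eq_ite`), exactly as in `sum_apply_inv_mul_classGroupLFunction`.
[cite: ThornerZaman2019, §4.2 (4.2)] -/
theorem sum_apply_inv_mul_chebyshevThetaIdealChar (C : ClassGroup (𝓞 K)) (x : ℝ) :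
    ∑ ψ : AddChar (Additive (ClassGroup (𝓞 K))) ℂ,
        ψ (Additive.ofMul C⁻¹) * chebyshevThetaIdealChar K (toMulHom ψ).toHomUnits x =
      (Fintype.card (ClassGroup (𝓞 K)) : ℂ) * (chebyshevThetaIdealClass K C x : ℂ) := by
  classical
  simp_rw [chebyshevThetaIdealChar, toHomUnits_toMulHom_apply, mul_sum]
  rw [sum_comm]
  have key : ∀ C' : ClassGroup (𝓞 K),
      ∑ ψ : AddChar (Additive (ClassGroup (𝓞 K))) ℂ, ψ (Additive.ofMul C⁻¹) *
          (ψ (Additive.ofMul C') * (chebyshevThetaIdealClass K C' x : ℂ)) =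
        (if C = C' then (Fintype.card (ClassGroup (𝓞 K)) : ℂ) else 0) *
          (chebyshevThetaIdealClass K C' x : ℂ) := by
    intro C'
    simp_rw [← mul_assoc, ← AddChar.map_add_eq_mul]
    rw [← sum_mul, ← ofMul_mul, sum_classGroupChar_apply_eq_ite]
    by_cases hC : C = C'
    · rw [if_pos hC, if_pos (inv_mul_eq_one.2 hC)]
    · rw [if_neg hC, if_neg (mt inv_mul_eq_one.1 hC)]
  simp_rw [key, ite_mul, zero_mul]
  rw [sum_ite_eq univ C, if_pos (mem_univ C)]

/-- **Inversion: `θ_C(x) = h⁻¹ Σ_ψ ψ(C⁻¹) θ(x, ψ)`** (finite Fourier inversion on `Cl_K`); with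
`ψ(C⁻¹) = ψ̄(C)` this is the passage from character sums to class sums of
[ThornerZaman2019, (4.2)], for the unsmoothed prime sums. [cite: ThornerZaman2019, §4.2 (4.2)] -/
theorem chebyshevThetaIdealClass_eq_sum_chebyshevThetaIdealChar (C : ClassGroup (𝓞 K)) (x : ℝ) :
    (chebyshevThetaIdealClass K C x : ℂ) =
      (Fintype.card (ClassGroup (𝓞 K)) : ℂ)⁻¹ *
        ∑ ψ : AddChar (Additive (ClassGroup (𝓞 K))) ℂ,
          ψ (Additive.ofMul C⁻¹) * chebyshevThetaIdealChar K (toMulHom ψ).toHomUnits x := by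
  rw [sum_apply_inv_mul_chebyshevThetaIdealChar, ← mul_assoc, inv_mul_cancel₀, one_mul]
  exact_mod_cast Fintype.card_ne_zero

/-- The same with the class number `h_K` (`|Cl_K| = h_K`). [folklore] -/
theorem chebyshevThetaIdealClass_eq_classNumber_inv_mul_sum (C : ClassGroup (𝓞 K)) (x : ℝ) :
    (chebyshevThetaIdealClass K C x : ℂ) =
      (classNumber K : ℂ)⁻¹ *
        ∑ ψ : AddChar (Additive (ClassGroup (𝓞 K))) ℂ,
          ψ (Additive.ofMul C⁻¹) * chebyshevThetaIdealChar K (toMulHom ψ).toHomUnits x := by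
  rw [chebyshevThetaIdealClass_eq_sum_chebyshevThetaIdealChar]
  rfl

end Literature.NumberTheory.LFunctions.NumberField

end
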